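import Summits.CriticalPhenomena.PercolationContinuityZ3.Theorems.SahiBoxTP2LocalApproximation

/-!
# Sahi's Theorem 2 with two free NON-LOCAL slots for box-TP₂ spin laws and for the infinite-volume Ising states

Support file of the Sahi cell (`prim-sahi`, typer seat, generation 15; `--supports stmt-CriticalPhenomena-4575`).
Theorems only (no definitions, no named facts, no sorries).  Generation 13 (`SahiIsingCumulations.lean`) proved
Sahi's Theorem 2 / Blinovsky's theorem with two free slots for box-TP₂ laws on `{−1,+1}^ι` when all slots are
LOCAL; here the two free slots are ARBITRARY bounded measurable increasing functionals of the infinite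
configuration (tail events included), by the martingale approximation theorem
`IsBoxTP2.exists_local_monotone_tendsto_ae` of `SahiBoxTP2LocalApproximation.lean` (local increasing approximants
= monotone versions of the window conditional expectations, Lévy's upward theorem) and the a.e.-limit lemma
`msahiE_nonneg_of_tendsto_ae`.

* `msahiE_nonneg_offTwo_of_isBoxTP2` — **for a box-TP₂ probability measure on `{−1,+1}^ι` (`ι` countably
  infinite) and every `n`: `0 ≤ E_n(f_0,…,f_{n−1})` whenever at most two slots are arbitrary bounded measurable
  nonnegative increasing functionals and every other slot is the indicator of an all-plus event
  `{σ_v = +1 ∀ v ∈ A_i}` (`A_i` finite)**; `sahiE3_plusSpins_nonneg_of_isBoxTP2` — `n = 3` displayed: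
  `0 ≤ 2μ(P_A ∩ B ∩ C) + μ(P_A)μ(B)μ(C) − μ(P_A)μ(B ∩ C) − μ(B)μ(P_A ∩ C) − μ(C)μ(P_A ∩ B)` for ARBITRARY
  measurable increasing events `B, C`.
* The Ising states on `ℤ^d` (`d ≥ 1`, `β ≥ 0`; plus/minus state any `h`, free state `h ≥ 0`):
  `plusState_msahiE_nonneg_plusSpins_offTwo'`, `plusState_sahiE3_plusSpins_nonneg'` (and `minusState_…'`,
  `freeState_…'`) — the generation-13 statements with the locality hypotheses on the free slots REMOVED.

No sorries, no new axioms.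
-/

noncomputable section

namespace Summit.CriticalPhenomena.PercolationContinuityZ3.Theorems.SahiBoxTP2

open MeasureTheory ProbabilityTheory Set Filter Topology Function Literature.Combinatorics.Sahi2008
open Literature.Probability.LatticeModels
open scoped ENNReal

section Spins

variable {ι : Type*} [Countable ι] [Infinite ι]

/-! ### Sahi's Theorem 2 with two free NON-LOCAL slots -/

/-- **Sahi's Theorem 2 / Blinovsky with two free NON-LOCAL slots, unconditionally, every order `n`**: for a
box-TP₂ probability measure `μ` on `{−1,+1}^ι` (`ι` countably infinite) and `f_0,…,f_{n−1}` such that the slots in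
a set `I` of at most two indices are ARBITRARY bounded measurable nonnegative increasing functionals of the
infinite configuration, and every other slot is the indicator of an all-plus event `{σ_v = +1 ∀ v ∈ A_i}` (`A_i`
finite): `0 ≤ E_n(f_0,…,f_{n−1})`.  Proof: replace the free slots by their local monotone approximants
(`IsBoxTP2.exists_local_monotone_tendsto_ae` along an exhaustion containing all `A_i`), apply generation 13's local
theorem, pass to the a.e. limit (`msahiE_nonneg_of_tendsto_ae`). [this work] -/
theorem msahiE_nonneg_offTwo_of_isBoxTP2 (μ : Measure (ι → ℤˣ)) [IsProbabilityMeasure μ] (hμ : IsBoxTP2 μ)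
    {n : ℕ} (f : Fin n → (ι → ℤˣ) → ℝ) (I : Finset (Fin n)) (hI : I.card ≤ 2)
    (hfm : ∀ i ∈ I, Measurable (f i)) (hf0 : ∀ i ∈ I, ∀ σ, 0 ≤ f i σ) {B : ℝ} (hfB : ∀ i ∈ I, ∀ σ, f i σ ≤ B)
    (hmono : ∀ i ∈ I, Monotone (f i)) (A : Fin n → Finset ι)
    (hcum : ∀ i, i ∉ I → f i = {σ : ι → ℤˣ | ∀ v ∈ A i, σ v = 1}.indicator 1) :
    0 ≤ msahiE μ n f := by
  classical
  obtain ⟨J₀, hJ₀m, hJ₀⟩ := exists_finset_exhaustion (ι := ι)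
  set J : ℕ → Finset ι := fun N => J₀ N ∪ Finset.univ.biUnion A with hJdef
  have hJm : Monotone J := fun N M hNM => Finset.union_subset_union (hJ₀m hNM) le_rfl
  have hJ : ∀ v, ∃ N, v ∈ J N := fun v => by
    obtain ⟨N, hN⟩ := hJ₀ v
    exact ⟨N, Finset.mem_union_left _ hN⟩
  have hAJ : ∀ i N, A i ⊆ J N := fun i N =>
    (Finset.subset_biUnion_of_mem A (Finset.mem_univ i)).trans Finset.subset_union_right
  -- local monotone approximants of the free slots
  have happrox : ∀ i, ∃ g : ℕ → (ι → ℤˣ) → ℝ, i ∈ I → (∀ N, DependsOn (g N) (↑(J N) : Set ι)) ∧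
      (∀ N, Monotone (g N)) ∧ (∀ N, Measurable (g N)) ∧ (∀ N σ, 0 ≤ g N σ) ∧ (∀ N σ, g N σ ≤ B) ∧
      ∀ᵐ σ ∂μ, Tendsto (fun N => g N σ) atTop (𝓝 (f i σ)) := by
    intro i
    by_cases hi : i ∈ I
    · obtain ⟨g, hg⟩ := hμ.exists_local_monotone_tendsto_ae μ hJm hJ (hmono i hi) (hfm i hi) (hf0 i hi)
        (hfB i hi)
      exact ⟨g, fun _ => hg⟩
    · exact ⟨fun _ => f i, fun h => absurd h hi⟩
  choose g hg using happrox
  set F : ℕ → Fin n → (ι → ℤˣ) → ℝ := fun N i => if i ∈ I then g i N else f i with hFdef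
  have hFI : ∀ N, ∀ i ∈ I, F N i = g i N := fun N i hi => by simp only [hFdef, hi, if_true]
  have hFnI : ∀ N i, i ∉ I → F N i = {σ : ι → ℤˣ | ∀ v ∈ A i, σ v = 1}.indicator 1 := fun N i hi => by
    simp only [hFdef, hi, if_false]; exact hcum i hi
  have hind01 : ∀ i (σ : ι → ℤˣ), 0 ≤ ({σ : ι → ℤˣ | ∀ v ∈ A i, σ v = 1}.indicator (1 : (ι → ℤˣ) → ℝ)) σ ∧
      ({σ : ι → ℤˣ | ∀ v ∈ A i, σ v = 1}.indicator (1 : (ι → ℤˣ) → ℝ)) σ ≤ 1 := fun i σ => by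
    by_cases h : σ ∈ {σ : ι → ℤˣ | ∀ v ∈ A i, σ v = 1}
    · simp [Set.indicator_of_mem h]
    · simp [Set.indicator_of_notMem h]
  -- positivity for the approximants: the local theorem
  have hpos : ∀ N, 0 ≤ msahiE μ n (F N) := by
    intro N
    refine msahiE_nonneg_offTwo_of_isBoxTP2_local μ hμ (J N) (F N) (fun i => ?_) (fun i σ => ?_)
      (fun i => ?_) I hI A (hFnI N)
    · by_cases hi : i ∈ I
      · rw [hFI N i hi]; exact (hg i hi).1 N
      · rw [hFnI N i hi]; exact dependsOn_indicator_plusSpins (hAJ i N)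
    · by_cases hi : i ∈ I
      · rw [hFI N i hi]; exact (hg i hi).2.2.2.1 N σ
      · rw [hFnI N i hi]; exact (hind01 i σ).1
    · by_cases hi : i ∈ I
      · rw [hFI N i hi]; exact (hg i hi).2.1 N
      · rw [hFnI N i hi]
        exact Literature.Probability.Percolation.KNPreFKG.monotone_indicator_one_of_isUpperSet
          (isUpperSet_forall_mem_eq_one (A i))
  -- pass to the limit
  refine msahiE_nonneg_of_tendsto_ae μ F f (fun N i => ?_) (C := max B 1) (fun N i σ => ?_) (fun i => ?_) hpos
  · by_cases hi : i ∈ I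
    · rw [hFI N i hi]; exact (hg i hi).2.2.1 N
    · rw [hFnI N i hi]; exact measurable_one.indicator (measurableSet_forall_mem_eq_one (A i))
  · by_cases hi : i ∈ I
    · rw [hFI N i hi, abs_of_nonneg ((hg i hi).2.2.2.1 N σ)]
      exact ((hg i hi).2.2.2.2.1 N σ).trans (le_max_left _ _)
    · rw [hFnI N i hi, abs_of_nonneg (hind01 i σ).1]
      exact (hind01 i σ).2.trans (le_max_right _ _)
  · by_cases hi : i ∈ I
    · simp only [hFdef, hi, if_true]
      exact (hg i hi).2.2.2.2.2
    · simp only [hFdef, hi, if_false]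
      exact Eventually.of_forall fun σ => tendsto_const_nhds

/-- **`n = 3` displayed, unconditionally, NON-LOCAL events**: for a box-TP₂ probability measure `μ` on
`{−1,+1}^ι`, a finite set of sites `A` and ARBITRARY measurable increasing events `B, C` of the infinite
configuration: `0 ≤ 2μ(P_A ∩ B ∩ C) + μ(P_A)μ(B)μ(C) − μ(P_A)μ(B ∩ C) − μ(B)μ(P_A ∩ C) − μ(C)μ(P_A ∩ B)`,
`P_A = {σ_A ≡ +}`. [this work] -/
theorem sahiE3_plusSpins_nonneg_of_isBoxTP2 (μ : Measure (ι → ℤˣ)) [IsProbabilityMeasure μ]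
    (hμ : IsBoxTP2 μ) (A : Finset ι) {B C : Set (ι → ℤˣ)} (hBm : MeasurableSet B) (hB : IsUpperSet B)
    (hCm : MeasurableSet C) (hC : IsUpperSet C) :
    0 ≤ sahiE3 μ {σ : ι → ℤˣ | ∀ v ∈ A, σ v = 1} B C := by
  rw [← msahiE_three_indicator _ (measurableSet_forall_mem_eq_one A) hBm hCm]
  have hind : ∀ {S : Set (ι → ℤˣ)} (σ : ι → ℤˣ), 0 ≤ S.indicator (1 : (ι → ℤˣ) → ℝ) σ ∧
      S.indicator (1 : (ι → ℤˣ) → ℝ) σ ≤ 1 := fun {S} σ => by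
    by_cases h : σ ∈ S
    · simp [Set.indicator_of_mem h]
    · simp [Set.indicator_of_notMem h]
  refine msahiE_nonneg_offTwo_of_isBoxTP2 μ hμ _ ({1, 2} : Finset (Fin 3)) (by decide) ?_ ?_ (B := 1) ?_ ?_
    ![A, A, A] ?_
  · intro k hk
    fin_cases k
    · simp at hk
    · exact measurable_one.indicator hBm
    · exact measurable_one.indicator hCm
  · intro k _ σ
    fin_cases k <;> exact (hind σ).1
  · intro k _ σ
    fin_cases k <;> exact (hind σ).2
  · intro k hk
    fin_cases k
    · simp at hk
    · exact Literature.Probability.Percolation.KNPreFKG.monotone_indicator_one_of_isUpperSet hB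
    · exact Literature.Probability.Percolation.KNPreFKG.monotone_indicator_one_of_isUpperSet hC
  · intro k hk
    fin_cases k
    · rfl
    · simp at hk
    · simp at hk

end Spins

/-! ### The Ising states on `ℤ^d` -/

section Ising

variable {d : ℕ} [NeZero d] {β h : ℝ} {n : ℕ}

/-- **Sahi's Theorem 2 with two free NON-LOCAL slots for the PLUS STATE, unconditionally, every `n`** (`d ≥ 1`,
`β ≥ 0`, any `h`): for every probability measure on `{−1,+1}^{ℤ^d}` with the plus correlations, `0 ≤ E_n(f)` when
at most two slots are arbitrary bounded measurable nonnegative increasing functionals of the infinite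
configuration and the others are indicators of all-plus events of finite sets. [this work] -/
theorem plusState_msahiE_nonneg_plusSpins_offTwo' (hβ : 0 ≤ β) (μ : Measure (SpinConfig (Site d)))
    [IsProbabilityMeasure μ] (hμ : ∀ B : Finset (Site d), spinCorr μ B = plusCorr d β h B)
    (f : Fin n → SpinConfig (Site d) → ℝ) (I : Finset (Fin n)) (hI : I.card ≤ 2)
    (hfm : ∀ i ∈ I, Measurable (f i)) (hf0 : ∀ i ∈ I, ∀ σ, 0 ≤ f i σ) {B : ℝ}
    (hfB : ∀ i ∈ I, ∀ σ, f i σ ≤ B) (hmono : ∀ i ∈ I, Monotone (f i)) (A : Fin n → Finset (Site d))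
    (hcum : ∀ i, i ∉ I → f i = {σ : SpinConfig (Site d) | ∀ v ∈ A i, σ v = 1}.indicator 1) :
    0 ≤ msahiE μ n f := by
  haveI : Infinite (Site d) := infinite_site_of_neZero
  exact msahiE_nonneg_offTwo_of_isBoxTP2 μ (isBoxTP2_of_forall_spinCorr_eq_plusCorr hβ μ hμ) f I hI hfm hf0 hfB
    hmono A hcum

/-- **PLUS STATE, `n = 3` displayed, NON-LOCAL events**: for `β ≥ 0`, any `h`, a finite set of sites `A` and
ARBITRARY measurable increasing events `B, C` of the infinite configuration:
`0 ≤ 2μ⁺(P_A ∩ B ∩ C) + μ⁺(P_A)μ⁺(B)μ⁺(C) − μ⁺(P_A)μ⁺(B ∩ C) − μ⁺(B)μ⁺(P_A ∩ C) − μ⁺(C)μ⁺(P_A ∩ B)`.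
[this work] -/
theorem plusState_sahiE3_plusSpins_nonneg' (hβ : 0 ≤ β) (μ : Measure (SpinConfig (Site d)))
    [IsProbabilityMeasure μ] (hμ : ∀ B : Finset (Site d), spinCorr μ B = plusCorr d β h B) (A : Finset (Site d))
    {B C : Set (SpinConfig (Site d))} (hBm : MeasurableSet B) (hB : IsUpperSet B) (hCm : MeasurableSet C)
    (hC : IsUpperSet C) : 0 ≤ sahiE3 μ {σ : SpinConfig (Site d) | ∀ v ∈ A, σ v = 1} B C := by
  haveI : Infinite (Site d) := infinite_site_of_neZero
  exact sahiE3_plusSpins_nonneg_of_isBoxTP2 μ (isBoxTP2_of_forall_spinCorr_eq_plusCorr hβ μ hμ) A hBm hB hCm hC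

/-- The MINUS STATE, two free non-local slots (`β ≥ 0`, any `h`). [this work] -/
theorem minusState_msahiE_nonneg_plusSpins_offTwo' (hβ : 0 ≤ β) (μ : Measure (SpinConfig (Site d)))
    [IsProbabilityMeasure μ] (hμ : ∀ B : Finset (Site d), spinCorr μ B = minusCorr d β h B)
    (f : Fin n → SpinConfig (Site d) → ℝ) (I : Finset (Fin n)) (hI : I.card ≤ 2)
    (hfm : ∀ i ∈ I, Measurable (f i)) (hf0 : ∀ i ∈ I, ∀ σ, 0 ≤ f i σ) {B : ℝ}
    (hfB : ∀ i ∈ I, ∀ σ, f i σ ≤ B) (hmono : ∀ i ∈ I, Monotone (f i)) (A : Fin n → Finset (Site d))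
    (hcum : ∀ i, i ∉ I → f i = {σ : SpinConfig (Site d) | ∀ v ∈ A i, σ v = 1}.indicator 1) :
    0 ≤ msahiE μ n f := by
  haveI : Infinite (Site d) := infinite_site_of_neZero
  exact msahiE_nonneg_offTwo_of_isBoxTP2 μ (isBoxTP2_of_forall_spinCorr_eq_minusCorr hβ μ hμ) f I hI hfm hf0 hfB
    hmono A hcum

/-- MINUS STATE, `n = 3` displayed, non-local events. [this work] -/
theorem minusState_sahiE3_plusSpins_nonneg' (hβ : 0 ≤ β) (μ : Measure (SpinConfig (Site d)))
    [IsProbabilityMeasure μ] (hμ : ∀ B : Finset (Site d), spinCorr μ B = minusCorr d β h B) (A : Finset (Site d))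
    {B C : Set (SpinConfig (Site d))} (hBm : MeasurableSet B) (hB : IsUpperSet B) (hCm : MeasurableSet C)
    (hC : IsUpperSet C) : 0 ≤ sahiE3 μ {σ : SpinConfig (Site d) | ∀ v ∈ A, σ v = 1} B C := by
  haveI : Infinite (Site d) := infinite_site_of_neZero
  exact sahiE3_plusSpins_nonneg_of_isBoxTP2 μ (isBoxTP2_of_forall_spinCorr_eq_minusCorr hβ μ hμ) A hBm hB hCm hC

/-- The FREE STATE, two free non-local slots (`β ≥ 0`, `h ≥ 0`). [this work] -/
theorem freeState_msahiE_nonneg_plusSpins_offTwo' (hβ : 0 ≤ β) (hh : 0 ≤ h) (μ : Measure (SpinConfig (Site d)))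
    [IsProbabilityMeasure μ] (hμ : ∀ B : Finset (Site d), spinCorr μ B = freeCorr d β h B)
    (f : Fin n → SpinConfig (Site d) → ℝ) (I : Finset (Fin n)) (hI : I.card ≤ 2)
    (hfm : ∀ i ∈ I, Measurable (f i)) (hf0 : ∀ i ∈ I, ∀ σ, 0 ≤ f i σ) {B : ℝ}
    (hfB : ∀ i ∈ I, ∀ σ, f i σ ≤ B) (hmono : ∀ i ∈ I, Monotone (f i)) (A : Fin n → Finset (Site d))
    (hcum : ∀ i, i ∉ I → f i = {σ : SpinConfig (Site d) | ∀ v ∈ A i, σ v = 1}.indicator 1) :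
    0 ≤ msahiE μ n f := by
  haveI : Infinite (Site d) := infinite_site_of_neZero
  exact msahiE_nonneg_offTwo_of_isBoxTP2 μ (isBoxTP2_of_forall_spinCorr_eq_freeCorr hβ hh μ hμ) f I hI hfm hf0
    hfB hmono A hcum

/-- FREE STATE (`h ≥ 0`), `n = 3` displayed, non-local events. [this work] -/
theorem freeState_sahiE3_plusSpins_nonneg' (hβ : 0 ≤ β) (hh : 0 ≤ h) (μ : Measure (SpinConfig (Site d)))
    [IsProbabilityMeasure μ] (hμ : ∀ B : Finset (Site d), spinCorr μ B = freeCorr d β h B) (A : Finset (Site d))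
    {B C : Set (SpinConfig (Site d))} (hBm : MeasurableSet B) (hB : IsUpperSet B) (hCm : MeasurableSet C)
    (hC : IsUpperSet C) : 0 ≤ sahiE3 μ {σ : SpinConfig (Site d) | ∀ v ∈ A, σ v = 1} B C := by
  haveI : Infinite (Site d) := infinite_site_of_neZero
  exact sahiE3_plusSpins_nonneg_of_isBoxTP2 μ (isBoxTP2_of_forall_spinCorr_eq_freeCorr hβ hh μ hμ) A hBm hB
    hCm hC

end Ising

end Summit.CriticalPhenomena.PercolationContinuityZ3.Theorems.SahiBoxTP2
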